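import Mathlib
import HarnessLib
import HarnessLib.Audit
import Summits.QuantumAdvantage.Statement
import Literature.Computability.QuantumComplexity.StabilizerRank

/-!
Route: MagicSpectrum

CLOSED (retired) 2026-08-15T13:50:52Z by operator:999:1257524 — reason: not-a-thesis: assembly does not conclude the sub-problem Statement — note: D-0027 §2.1 audit (human 2026-08-15: routes that do not decide the summit are removed): the assembly concludes `KillApproxRank`, not the sub-problem statement; a NEW conforming route may be opened from the same idea (generated `closes : … → _root_.QuantumAdvantage`).. The file is kept as the record of this route; refuted decls are indexed as negative knowledge (`ledger negatives`).

# Route QuantumAdvantage/MagicSpectrum — the asymptotic spectrum of magic (NEGATIVE-SIDE KILL ROUTE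
for Dequantize's stabilizer-rank hypothesis)

Realises idea card magic-asymptotic-spectrum (Strassen duality transplanted to stabilizer rank).

## Thesis X
Words: the asymptotic spectrum of magic has a point exceeding 1 at |T⟩ — there is a functional F on
multi-qubit
state vectors that vanishes at 0, is ≤ 1 on stabilizer states, subadditive (merging), scalar- and
Clifford-monotone,
multiplicative under tensor product, monotone under the ⟨0|-projection of a qubit, normalised on the
empty register,
with F(|T⟩) > 1; and (kill form, crux RobustSpectralPoint) such an F stays ≥ c^t on the whole δ-ball
around |T⟩^{⊗t}.
Lean (crux SpectralPointAtT): `∃ F : (n : ℕ) → (QReg n → ℂ) → ℝ, (∀ n, F n 0 = 0) ∧ (∀ n, ∀ φ ∈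
stabilizerStates n, F n φ ≤ 1)
 ∧ (subadditive) ∧ (∀ c, F n (c • ψ) ≤ F n ψ) ∧ (∀ C ∈ cliffordCircuits n, F n (C.mulVec ψ) ≤ F n ψ)
 ∧ (F (a+b) (tensorVec ψ φ) = F a ψ * F b φ) ∧ (F n (fun x => ψ (Fin.snoc x false)) ≤ F (n+1) ψ) ∧ F
0 1 = 1 ∧ 1 < F 1 magicT`
(all constants in Literature.Computability.QuantumComplexity.StabilizerRank /
Literature.Computability.Cryptography.QubitRegister).

## What X is equivalent to, and what it kills
By SOUNDNESS (support SpectralLowerBound: F ≤ stabilizerRank pointwise) and COMPLETENESS (support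
StrassenCompleteness:
Strassen/Zuiddam duality, PROVED in the tree as
Literature.Computability.AlgebraicComplexity.IsStrassenPreorder.exists_isSpectralPoint_eq_asympRankOf,
instantiated on the magic semiring) X ⇔ lim_t χ(|T⟩^{⊗t})^{1/t} > 1, i.e. EXPONENTIAL exact
stabilizer rank of magic
states (open; in print Ω̃(t²) ≤ χ ≤ 2^{0.396 t}). The robust crux gives χ_δ(|T⟩^{⊗t}) ≥ c^t, i.e.
the shared kill item
stmt-QuantumAdvantage-0247 = Dequantize.DeqNegStabrankSuperpoly (filed here verbatim as
KillApproxRank).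

## Assembly (ladder; ends in the KILL ITEM by design — this route proves neither QuantumAdvantage
nor its negation)
`NontrivialSpectrum → SpectralPointAtT → RobustSpectralPoint → KillApproxRank`
(each hypothesis implies the previous one; the chain is provable from RobustSpectralPoint +
SpectralLowerBound alone).
Bearing on the summit: KillApproxRank refutes hypothesis (a) of Dequantize crux 0244 / the
hypothesis of 0470 and closes
the stabilizer-rank road to ¬QuantumAdvantage (Dequantize's own kill criterion); the duality is an
engine for BOTH sides
(¬NontrivialSpectrum = 'the magic spectrum is trivial' would give 2^{o(t)} exact decompositions of
|T⟩^{⊗t}).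

Rationale: WHY THIS LINE. Every stabilizer-rank lower bound in print is one-shot and polynomial
(PelegShpilkaVolk2022, Labib2022,
LovitzSteffan2022, MehrabanTahmasbi2024 Thm 1.1: Ω̃(t²); KalraSinha2026), while "we expect χ(T^{⊗m})
to grow
exponentially" (MT24 p.3). Strassen's theory of asymptotic spectra (Strassen1988; Zuiddam2018 Ch.2;
ChristandlVranaZuiddam2023) is the one framework in which exponential rank growth is CHARACTERISED:
on the magic semiring
(formal sums of states; preorder = stabilizer operations + MERGING [ψ]⊕[φ] ≽ [ψ+φ] + discarding)
stabilizer rank is the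
rank function, and lim χ(T^{⊗t})^{1/t} = max over spectral points F of F(T). Imported area:
algebraic complexity /
asymptotic spectra — and the import is already FORMALISED for the MatrixMultiplication summit
(Literature.Computability.AlgebraicComplexity.StrassenPreorder*, StrassenSpectralTheorem:
IsStrassenPreorder, IsSpectralPoint,
rankOf, asympRankOf, exists_isSpectralPoint_eq_asympRankOf all proved), so only the magic instance
must be built. Cruxes are
stated EXTENSIONALLY over StabilizerRank.lean (no new definition needed to type them);
representation theory of Clifford
tensor powers (GrossNezamiWalter2021, MontealegreMoraGross2022) is the proposed source of explicit
spectral points.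

RANKED CRUXES. (2) SpectralPointAtT — exhibit ONE functional with the eight axioms and F(T) > 1 [⇔
exponential exact rank].
(3) NontrivialSpectrum — some spectral point exceeds 1 on SOME state [⇔ some fixed ψ has χ(ψ^{⊗k}) ≥
c^k; open for every ψ;
first candidate ψ_α of LovitzSteffan2022 Thm 4.1]. (4) RobustSpectralPoint — an F that stays ≥ c^t
on the δ-ball of
T^{⊗t} [⇒ kill item 0247 in exponential form; card N3, genuinely beyond Strassen]. Supports:
SpectralLowerBound (soundness,
elementary), StrassenCompleteness (duality instance; known mathematics, size L; definition
MagicClass requested).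
Target KillApproxRank = stmt-0247 verbatim (shared with Dequantize). Assembly = the ladder.

KILL CRITERIA. ¬NontrivialSpectrum (trivial magic spectrum: the transplant of Strassen's
asymptotic-rank conjecture) or
¬SpectralPointAtT (χ(T^{⊗t}) = 2^{o(t)}) proved ⇒ close refuted (either theorem is itself a landmark
for the ¬S side).
RobustSpectralPoint refuted with SpectralPointAtT alive ⇒ drop the kill claim, keep the exact line
(target := exp. exact rank).

NOT DECOMPOSED YET. The construction programme for F (GNW/Howe isotypic weights of ψ^{⊗k}, entropic
functionals à la CVZ
quantum functionals); the measurement-closure lemma inside StrassenCompleteness;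
uniformity/algorithmic content (none needed
for a kill). Dead candidates checked while planning (why crux 2 is hard): low-rank linear
flattenings (no quadric/cubic
vanishes on Stab_n — Clifford 3-design), monoidal flattenings = product-test counting functionals (>
1 on generic entangled
stabilizer states), min-support over Cliffords and 2^{nullity} (violate merging), Barnes–Wall norm
(KalraSinha2026 Thm 5:
multiplicative, = 1 exactly on stabilizer states, not subadditive).

NOVELTY (summary; full text in the Novelty field). Nearest prior: CVZ quantum functionals
arXiv:1709.07851 (GL template),
JensenVrana2020 (the one quantum-state spectrum: LOCC, not magic), KalraSinha2026 (multiplicative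
magic monotone, 2^{Ω(n)}
growth, no merging axiom), LovitzSteffan2022 §4 (χ multiplicative for two copies). Delta:
merging-semiring making χ a Strassen
rank + duality (abstract half already a theorem here) + axioms A0–A8 + nontriviality crux. Card
graded new-combination.
VS SIBLING ROUTES sharing target 0247: CodeFlattening = RANK METHODS (degree-k linear flattenings +
rank subadditivity, GNW code
operators); spectral points are NOT rank methods (low-normalisation flattenings are ≡ 1 here) but
multiplicative+additive
monotones, complete for exponential growth by duality (tensor-world split 'flattenings vs quantum
functionals'); shared: only
0247 and GNW. Dequantize owns 0247 as its ¬crux; card counterfeit-magic-dichotomy owns the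
continuous/extent side.
BARRIERS (summary). SeparationPrerequisites / Relativization / Algebrization / NaturalProofs: none
engaged (negative-side
resource lower bound about explicit finite states); details and the non-catalogued rank-method
barrier in the Barriers field.

Novelty: NEAREST PRIOR ART (searched 2026-08-15 by this planner: zbMATH "asymptotic spectrum tensors" /
"stabilizer rank lower bound"; Crossref "asymptotic stabilizer rank magic", "asymptotic spectra
quantum resource preordered semiring"; `lit search --hybrid "multiplicative magic monotone lower
bound stabilizer rank tensor power"`; `lit galaxy search "asymptotic spectrum of LOCC" --star all`,
`lit galaxy search "stabilizer rank" --star pdf` (11 hits incl. Lovitz's project description and OWR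
49/2021); `lit frontier QuantumAdvantage --since 2020`, `lit bridges QuantumAdvantage --cross any`;
reads: arXiv:2503.04101 pp.4,15, arXiv:2110.07781 pp.4,12, arXiv:2305.10277 p.3; arXiv/S2/OpenAlex
APIs rate-limited at search time — gap; plus the card's own searches and the refuter novelty audit
of 2026-08-15 grading the card new-combination with prior doi:10.1515/crll.1988.384.102,
arXiv:1709.07851, arXiv:1807.05130, arXiv:2003.13835, arXiv:2003.14176, arXiv:1712.08628,
doi:10.22331/q-2021-12-20-606, arXiv:2503.04101).
(A) Asymptotic spectra: Strassen1988 (Thm 3.8), Zuiddam2018 Ch.2 (Cor 2.13),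
ChristandlVranaZuiddam2023 = arXiv:1709.07851 (quantum functionals: the GL template for explicit
spectral points); its only quantum-STATE instance is the asymptotic spectrum of LOCC,
JensenVrana2020 = arXiv:1807.05130 (entanglement transformations, not magic / stabilizer rank). In
THIS tree the abstract theory is already formalised and PROVED for the MatrixMultiplication summit:
Literature.Computability.  [refs: 10.1515/crll.1988.384.102, 10.22331/q-2021-12-20-606, 2503.04101, 2110.07781, 2305.10277, 1709.07851, 1807.05130, 2003.13835, 2003.14176, 1712.08628, doi:10.1515/crll.1988.384.102, doi:10.22331/q-2021-12-20-606, Strassen1988, Zuiddam2018, ChristandlVranaZuiddam2023, JensenVrana2020, QassimPashayanGosset2021, PelegShpilkaVolk2022, Labib2022, LovitzSteffan2022, MehrabanTahmasbi2024, KalraSinha2026, ]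

Barriers (technique_class: asymptotic-spectra, stabilizer-rank, duality): technique_class: asymptotic-spectra, stabilizer-rank, duality
- Literature.Barriers.QuantumAdvantage.SeparationPrerequisites: not engaged — the route proves a
lower bound on a simulation RESOURCE (stabilizer rank of explicit magic states) on the negative side
and refutes the hypothesis of route Dequantize; it claims no class separation and its assembly ends,
by design, in the shared kill item stmt-QuantumAdvantage-0247, not in QuantumAdvantage.
- Literature.Barriers.QuantumAdvantage.Relativization: not engaged — every statement is about
explicit finite state vectors (QReg n → ℂ), Clifford circuits and stabilizer decompositions; there
is no oracle and nothing relativizes (same verdict as for Dequantize itself, whose simulation is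
non-black-box).
- Literature.Barriers.QuantumAdvantage.Algebrization: not engaged — no inclusion/separation argument
of the form C^A vs D^Ã; spectral points are functionals on states, not arithmetizations.
- Literature.Barriers.QuantumAdvantage.NaturalProofs: informative analogy only — a spectral point F
is a 'property of states useful against stabilizer decompositions', but usefulness here is against
r-term stabilizer sums, not against P/poly circuits, and neither largeness nor P/poly-constructivity
of F is claimed or needed (Strassen's existence proof is non-constructive: Zorn / total extensions);
Razborov–Rudich constrains natural properties against P/poly under HardPRGExist and says nothing
about rank functionals on 2^n-dimensional state spaces. T

History (route lifecycle, newest last):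
- 2026-08-15T13:50:52Z · CLOSED retired — not-a-thesis: assembly does not conclude the sub-problem Statement (operator:999:1257524)

sub-problem: QuantumAdvantage · status: closed(retired) · opened planner-plancard-QuantumAdvantage-QuantumAdva-5237de9a-0 2026-08-15T11:03:06Z · rev 0 · ledger route-QuantumAdvantage-MagicSpectrum
GENERATED by the gate from the ledger (D-0016/17). Provers cite these decls: `theorem foo : Summit.QuantumAdvantage.QuantumAdvantage.Theses.MagicSpectrum.<Decl> := …` in Summits/QuantumAdvantage/QuantumAdvantage/Theorems/<Name>.lean.
-/

namespace Summit.QuantumAdvantage.QuantumAdvantage.Theses.MagicSpectrum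

open scoped BigOperators Topology Manifold Classical MeasureTheory ProbabilityTheory Matrix InnerProductSpace ComplexConjugate ContinuousMap
open Filter Set Function TopologicalSpace MeasureTheory

attribute [summit_statement] _root_.QuantumAdvantage

open Literature.QuantumAdvantage

/-- item stmt-QuantumAdvantage-0247 · target · rank 0 · open · by planner
why it might fail: May be FALSE (poly χ_δ(T^{⊗t}) for every δ<1 not excluded; upper bound 2^{0.396t}); beyond every engine in print (Ω̃(t²), MT24 Thm 1.1); superpolynomial only conditionally (MT24 Thm 1.6).
sources: MehrabanTahmasbi2024, PelegShpilkaVolk2022, BravyiEtAl2019, KalraSinha2026, ledger stmt-QuantumAdvantage-0247 (route Dequantize, decl DeqNegStabrankSuperpoly)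
NEGATION of the hypothesis half of #2 (filed so the S-side is staffed): ∃ δ ∈ (0,1) such that for
every polynomial q there is t with χ_δ(|T⟩^{⊗t}) > q(t). OPEN; the best lower bounds in print are
Ω-polynomial of degree ≤ 2 (PelegShpilkaVolk2022 via higher-order Fourier analysis / quadratic phase
structure of stabilizer states, Labib2022, MehrabanTahmasbi2024 probabilistic method). Proving it
kills crux #2 of Dequantize (does NOT prove QuantumAdvantage). Imported field: additive
combinatorics (Gowers U³ inverse theory over 𝔽₂ⁿ). NEEDS DEFINITION: approxStabilizerRank.
[needs_definition: approxStabilizerRank] -/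
@[route_item "route-QuantumAdvantage-MagicSpectrum"]
def KillApproxRank : Prop :=
  ∃ δ : ℝ, 0 < δ ∧ δ < 1 ∧ ∀ c : ℕ, ∃ t : ℕ, t ^ c + c < Literature.Computability.QuantumComplexity.approxStabilizerRank δ (Literature.Computability.QuantumComplexity.tensorPow Literature.Computability.QuantumComplexity.magicT t)

/-- item stmt-QuantumAdvantage-2333 · crux · rank 2 · closed · moot by None · by planner
why it might fail: χ̃(T) may be 1: χ(T^{⊗t}) could be 2^{o(t)} (print: Ω̃(t²) ≤ χ ≤ 2^{0.396t}; the tensor analogue — Strassen's asymptotic rank conjecture — predicts a trivial spectrum); every multiplicative magic monotone in print (extent, nullity, BW norm) violates merging A3.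
sources: Strassen1988, Zuiddam2018, ChristandlVranaZuiddam2023, GrossNezamiWalter2021, MontealegreMoraGross2022, QassimPashayanGosset2021
[crux] A POINT OF THE ASYMPTOTIC SPECTRUM OF MAGIC EXCEEDING 1 AT |T⟩ (dual/certificate form of
EXPONENTIAL exact stabilizer rank). There is F : (n : ℕ) → (QReg n → ℂ) → ℝ with (A0) F n 0 = 0;
(A2) F ≤ 1 on stabilizerStates n; (A3) subadditive F(ψ+φ) ≤ Fψ + Fφ [merging]; (A4) scalar-monotone
F(c•ψ) ≤ Fψ; (A5) Clifford-monotone F(C ψ) ≤ Fψ for C ∈ cliffordCircuits n; (A6) multiplicative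
F(a+b)(tensorVec ψ φ) = F a ψ · F b φ; (A7) monotone under the ⟨0|-projection of the last qubit F n
(x ↦ ψ (Fin.snoc x false)) ≤ F (n+1) ψ; (A8) F 0 1 = 1; and 1 < F 1 magicT. (A0)–(A8) are exactly
what the restriction to single states of a spectral point (monotone semiring homomorphism → ℝ≥0,
Zuiddam2018 Def 2.8) of the MAGIC SEMIRING satisfies — formal sums of multi-qubit states, ⊗ =
tensorVec, preorder generated by Clifford circuits, complex scalars, |0⟩-adjunction, ⟨0|-projection,
MERGING [ψ]⊕[φ] ≽ [ψ+φ] and discarding, whose rank function is stabilizerRank. SpectralLowerBound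
gives χ(T^{⊗t}) ≥ (F 1 magicT)^t; StrassenCompleteness gives the converse from exponential exact
rank (Zuiddam Cor 2.13 = tree theorem
Literature.Computability.AlgebraicComplexity.IsStrassenPreorder.exists_isSpectralPoint_e -/
@[route_item "route-QuantumAdvantage-MagicSpectrum"]
def SpectralPointAtT : Prop :=
  ∃ F : (n : ℕ) → (Literature.Computability.Cryptography.QReg n → ℂ) → ℝ, (∀ n, F n 0 = 0) ∧ (∀ n, ∀ φ ∈ Literature.Computability.QuantumComplexity.stabilizerStates n, F n φ ≤ 1) ∧ (∀ n (ψ φ : Literature.Computability.Cryptography.QReg n → ℂ), F n (ψ + φ) ≤ F n ψ + F n φ) ∧ (∀ n (c : ℂ) (ψ : Literature.Computability.Cryptography.QReg n → ℂ), F n (c • ψ) ≤ F n ψ) ∧ (∀ n, ∀ C ∈ Literature.Computability.QuantumComplexity.cliffordCircuits n, ∀ ψ : Literature.Computability.Cryptography.QReg n → ℂ, F n (C.mulVec ψ) ≤ F n ψ) ∧ (∀ a b (ψ : Literature.Computability.Cryptography.QReg a → ℂ) (φ : Literature.Computability.Cryptography.QReg b → ℂ), F (a + b) (Literature.Computability.Cryptography.tensorVec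 ψ φ) = F a ψ * F b φ) ∧ (∀ n (ψ : Literature.Computability.Cryptography.QReg (n + 1) → ℂ), F n (fun x => ψ (Fin.snoc x false)) ≤ F (n + 1) ψ) ∧ F 0 (fun _ => 1) = 1 ∧ 1 < F 1 Literature.Computability.QuantumComplexity.magicT

/-- item stmt-QuantumAdvantage-2334 · crux · rank 3 · closed · moot by None · by planner
why it might fail: The spectrum may be trivial (F ≡ 1 on nonzero states): asymptotic subrank of every state is 1, nothing in print gives c^k rank growth for ANY fixed ψ, and all lower-bound engines are polynomial (PSV22 §1.5, MT24 Thm 1.1, LovitzSteffan2022 §3).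
sources: LovitzSteffan2022, QassimPashayanGosset2021, KalraSinha2026, PelegShpilkaVolk2022, MehrabanTahmasbi2024, Zuiddam2018
[crux] THE ASYMPTOTIC SPECTRUM OF MAGIC IS NONTRIVIAL: some F with (A0)–(A8) of SpectralPointAtT
exceeds 1 on SOME state ψ on some number a of qubits. By soundness (SpectralLowerBound) and Strassen
duality on the magic semiring (as in StrassenCompleteness, for the element [ψ] ≽ 1) this is
equivalent to: SOME fixed state ψ has exponentially growing stabilizer rank under tensor powers,
χ(ψ^{⊗k}) ≥ c^k with c > 1 — OPEN FOR EVERY ψ: QassimPashayanGosset2021 remark that no state with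
multiplicative stabilizer rank was known; LovitzSteffan2022 Thm 4.1 gives the first two-copy
examples ψ_α = e₀₀ + α(e₀₁+e₁₀), α transcendental, χ(ψ_α) = 2, χ(ψ_α^{⊗2}) = 4 (the natural first
candidate for full multiplicativity); KalraSinha2026 Thm 5: the Barnes–Wall norm has N(φ^{⊗n}) =
2^{Ω(n)} for every non-stabilizer φ but is not a rank bound. Weaker than SpectralPointAtT (take a =
1, ψ = magicT); the first viability test of the whole line, and two-sided: its negation ('the magic
spectrum is the single trivial point') would give 2^{o(k)} exact decompositions of every
tensor-power family — the transplant of Strassen's asymptotic rank conjecture. -/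
@[route_item "route-QuantumAdvantage-MagicSpectrum"]
def NontrivialSpectrum : Prop :=
  ∃ F : (n : ℕ) → (Literature.Computability.Cryptography.QReg n → ℂ) → ℝ, (∀ n, F n 0 = 0) ∧ (∀ n, ∀ φ ∈ Literature.Computability.QuantumComplexity.stabilizerStates n, F n φ ≤ 1) ∧ (∀ n (ψ φ : Literature.Computability.Cryptography.QReg n → ℂ), F n (ψ + φ) ≤ F n ψ + F n φ) ∧ (∀ n (c : ℂ) (ψ : Literature.Computability.Cryptography.QReg n → ℂ), F n (c • ψ) ≤ F n ψ) ∧ (∀ n, ∀ C ∈ Literature.Computability.QuantumComplexity.cliffordCircuits n, ∀ ψ : Literature.Computability.Cryptography.QReg n → ℂ, F n (C.mulVec ψ) ≤ F n ψ) ∧ (∀ a b (ψ : Literature.Computability.Cryptography.QReg a → ℂ) (φ : Literature.Computability.Cryptography.QReg b → ℂ), F (a + b) (Literature.Computability.Cryptography.tensorVec ψ φ) = F a ψ * F b φ) ∧ (∀ n (ψ : Literature.Computability.Cryptography.QReg (n + 1) → ℂ), F n (fun x => ψ (Fin.snoc x false)) ≤ F (n + 1) ψ) ∧ F 0 (fun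 _ => 1) = 1 ∧ ∃ (a : ℕ) (ψ : Literature.Computability.Cryptography.QReg a → ℂ), 1 < F a ψ

/-- item stmt-QuantumAdvantage-2335 · crux · rank 4 · closed · moot by None · by planner
why it might fail: Spectral points bound ASYMPTOTIC rank (F ≤ χ̃ ≤ χ) and are discontinuous; states δ-close to T^{⊗t} with subexponential χ̃ would defeat every F while 0247 still holds — approximate rank may be visible only to continuous extent/fidelity/BW-type monotones (KalraSinha2026 Thm 7, Problem 57).
sources: KalraSinha2026, LovitzSteffan2022, BravyiEtAl2019, BravyiGosset2016, MehrabanTahmasbi2024, JensenVrana2020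
[crux] δ-ROBUST SPECTRAL POINT (the kill upgrade; card N3, genuinely beyond Strassen's exact/border
theory): an F with (A0)–(A8) of SpectralPointAtT and constants δ ∈ (0,1), c > 1 such that c^t ≤ F t
φ for EVERY φ with normSq (tensorPow magicT t − φ) ≤ δ² (unnormalised φ, as in the tree's
approxStabilizerRank). With SpectralLowerBound: χ_δ(|T⟩^{⊗t}) ≥ c^t for all t, hence KillApproxRank
(0247) in EXPONENTIAL form; implies SpectralPointAtT (φ = T^{⊗t}, t = 1) and NontrivialSpectrum. Not
a restatement of exponential approximate rank: F must be multiplicative (A6) on everything.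
Smoothing a spectral point destroys multiplicativity and F ≤ asymptotic rank pointwise, so the crux
needs every state δ-close to T^{⊗t} to keep exponentially large ASYMPTOTIC rank. Known structure of
the δ-dependence: KalraSinha2026 Thm 8 (fidelity amplification: superpolynomial χ_δ for one δ ∈
(0,1) iff for all, even at polynomially small fidelity); LovitzSteffan2022 §3: product states with
exponential exact but constant approximate rank (exact ⇏ approximate in general); upper bound
χ_δ(T^{⊗t}) = O(δ⁻² 2^{0.23t}) (BravyiEtAl2019, BravyiGosset2016) so c ≤ 2^{0.23}. Candidate
mechanism: error-exponent / smooth- -/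
@[route_item "route-QuantumAdvantage-MagicSpectrum"]
def RobustSpectralPoint : Prop :=
  ∃ F : (n : ℕ) → (Literature.Computability.Cryptography.QReg n → ℂ) → ℝ, (∀ n, F n 0 = 0) ∧ (∀ n, ∀ φ ∈ Literature.Computability.QuantumComplexity.stabilizerStates n, F n φ ≤ 1) ∧ (∀ n (ψ φ : Literature.Computability.Cryptography.QReg n → ℂ), F n (ψ + φ) ≤ F n ψ + F n φ) ∧ (∀ n (c : ℂ) (ψ : Literature.Computability.Cryptography.QReg n → ℂ), F n (c • ψ) ≤ F n ψ) ∧ (∀ n, ∀ C ∈ Literature.Computability.QuantumComplexity.cliffordCircuits n, ∀ ψ : Literature.Computability.Cryptography.QReg n → ℂ, F n (C.mulVec ψ) ≤ F n ψ) ∧ (∀ a b (ψ : Literature.Computability.Cryptography.QReg a → ℂ) (φ : Literature.Computability.Cryptography.QReg b → ℂ), F (a + b) (Literature.Computability.Cryptography.tensorVec ψ φ) = F a ψ * F b φ) ∧ (∀ n (ψ : Literature.Computability.Cryptography.QReg (n + 1) → ℂ), F n (fun x => ψ (Fin.snoc x false)) ≤ F (n + 1) ψ) ∧ F 0 (fun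 _ => 1) = 1 ∧ ∃ δ c : ℝ, 0 < δ ∧ δ < 1 ∧ 1 < c ∧ ∀ (t : ℕ) (φ : Literature.Computability.Cryptography.QReg t → ℂ), Literature.Computability.Cryptography.normSq (Literature.Computability.QuantumComplexity.tensorPow Literature.Computability.QuantumComplexity.magicT t - φ) ≤ δ ^ 2 → c ^ t ≤ F t φ

/-- item stmt-QuantumAdvantage-2336 · support · rank 9 · closed · moot by None · by planner
sources: Zuiddam2018, BravyiSmithSmolin2016, AaronsonGottesman2004
[support] SOUNDNESS (easy half of the duality; provable now): if F n 0 = 0, F ≤ 1 on stabilizer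
states, F subadditive and scalar-monotone, then F n ψ ≤ stabilizerRank ψ for every ψ. Proof: every ψ
: QReg n → ℂ is a ℂ-combination of the 2^n computational basis states, which are stabilizer states
(pauliX = hGate·sGate·sGate·hGate as a word of placements applied to zeroState; cf.
CodeFlattening.StabDecompExists, same lemma), so the set in the sInf defining stabilizerRank is
nonempty and the infimum is attained by a decomposition ψ = Σ_{i<r} c_i φ_i with r = χ(ψ); then F ψ
≤ Σ_i F(c_i φ_i) ≤ Σ_i F φ_i ≤ r by induction over the Fin-sum (base case F 0 = 0 — NB the constant
functional F ≡ 1 satisfies all other axioms, so A0 is needed). Used by the Assembly together with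
A6/A8: F t (tensorPow magicT t) = (F 1 magicT)^t since tensorPow ψ (m+1) = tensorVec (tensorPow ψ m)
ψ and tensorPow ψ 0 = fun _ => 1. [Zuiddam2018 §2.8: φ(a) ≤ R(a); BravyiSmithSmolin2016 (χ)] -/
@[route_item "route-QuantumAdvantage-MagicSpectrum"]
def SpectralLowerBound : Prop :=
  ∀ F : (n : ℕ) → (Literature.Computability.Cryptography.QReg n → ℂ) → ℝ, (∀ n, F n 0 = 0) → (∀ n, ∀ φ ∈ Literature.Computability.QuantumComplexity.stabilizerStates n, F n φ ≤ 1) → (∀ n (ψ φ : Literature.Computability.Cryptography.QReg n → ℂ), F n (ψ + φ) ≤ F n ψ + F n φ) → (∀ n (c : ℂ) (ψ : Literature.Computability.Cryptography.QReg n → ℂ), F n (c • ψ) ≤ F n ψ) → ∀ n (ψ : Literature.Computability.Cryptography.QReg n → ℂ), F n ψ ≤ (Literature.Computability.QuantumComplexity.stabilizerRank ψ : ℝ)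

/-- item stmt-QuantumAdvantage-2337 · support · rank 9 · closed · moot by None · by planner
sources: Zuiddam2018, Strassen1988, ChristandlVranaZuiddam2023, AaronsonGottesman2004, Gottesman1998
[support] COMPLETENESS = Strassen duality instantiated (known mathematics; formalisation size L;
definition MagicClass requested): exponential exact rank (∃ c > 1 ∀ t, c^t ≤ χ(|T⟩^{⊗t})) →
SpectralPointAtT. Recipe: build the MAGIC SEMIRING M like
Literature.Computability.AlgebraicComplexity.TensorClass (TensorSemiring.lean /
TensorSemiringSpectrum.lean): elements = finite formal sums of pairs (n, ψ : QReg n → ℂ) modulo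
mutual derivability; ⊕ = formal sum, ⊗ = bilinear extension of tensorVec, 1 = [(0, fun _ => 1)], 0 =
∅; preorder X ≽ Y ('Y derivable from X') = closure under ⊕- and ⊗-contexts and transitivity of the
generators [ψ] ≽ [C.mulVec ψ] (C ∈ cliffordCircuits n), [ψ] ≽ [c • ψ] (c : ℂ, incl. 0), [ψ] ≽
[tensorVec ψ (zeroState 1)], [ψ] ≽ [fun x => ψ (Fin.snoc x false)], MERGING [ψ] ⊕ [φ] ≽ [ψ + φ], and
[0_n] ~ ∅ (discard/create zero). Prove IsStrassenPreorder: (1) ℕ order-embedded via the additive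
monotone Φ(X) = Σ_{[ψ]∈X} χ(ψ) — needs χ non-increasing under every generator in every ⊗-context;
for the projection this is the Aaronson–Gottesman measurement rule 'a Pauli/⟨0|-post-measurement of
a stabilizer state is a stabilizer state or 0' (AaronsonGottesman2004 §III; Gottesman19 -/
@[route_item "route-QuantumAdvantage-MagicSpectrum"]
def StrassenCompleteness : Prop :=
  (∃ c : ℝ, 1 < c ∧ ∀ t : ℕ, c ^ t ≤ (Literature.Computability.QuantumComplexity.stabilizerRank (Literature.Computability.QuantumComplexity.tensorPow Literature.Computability.QuantumComplexity.magicT t) : ℝ)) → SpectralPointAtT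

/-- item stmt-QuantumAdvantage-2338 · assembly · rank 1 · closed · moot by None · by planner
sources: Zuiddam2018
[assembly] LADDER NontrivialSpectrum → SpectralPointAtT → RobustSpectralPoint → KillApproxRank (each
hypothesis is implied by the next; the chain is provable from the LAST hypothesis alone via
SpectralLowerBound: for φ in the δ-ball χ(φ) ≥ F(φ) ≥ c^t, the sInf in approxStabilizerRank is
attained on a nonempty set (φ = T^{⊗t}), and c^t > t^k + k for large t since c > 1). KILL ROUTE: the
chain ends in the shared kill item 0247 by design, not in ±QuantumAdvantage. -/
@[route_item "route-QuantumAdvantage-MagicSpectrum"]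
def Assembly : Prop :=
  NontrivialSpectrum → SpectralPointAtT → RobustSpectralPoint → KillApproxRank

end Summit.QuantumAdvantage.QuantumAdvantage.Theses.MagicSpectrum
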